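import Literature.NumberTheory.ModularForms.DedekindSumRademacherPhi
import Mathlib.Algebra.BigOperators.Field
import HarnessLib

/-!
# Dedekind sums under the Hecke correspondence `T_ℓ`: the distribution relation of `((x))`,
# `s(qh, qk) = s(h, k)`, and Knopp's identity at a prime (proofs only)

Topic `Literature/NumberTheory/ModularForms`; namespace `Literature.NumberTheory.ModularForms`.
Theorem-only sequel of `DedekindSumRademacherPhi` (no definition, no named fact, no `sorry`).

* `sum_dedekindSaw_add_div` — the **distribution relation** of the sawtooth function:
  `∑_{m mod q} ((x + m/q)) = ((q x))` (`q ≥ 1`). [cite: RademacherGrosswald1972, Ch. 1 eq. (2) and Ch. 3 A]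
  [cite: Knopp1980, Lemma 1]
* `dedekindSum_mul_left_mul_right` — `s(qh, qk) = s(h, k)` for `q ≥ 1` (with the tree's definition of
  `s(h, k)` as a sum over a full residue system, no coprimality). [cite: Apostol1990, Ch. 3, Exercise 7]
* `sum_dedekindSum_add_mul_eq` — **Knopp's identity at a prime `ℓ`**:
  `∑_{m mod ℓ} s(h + m k, ℓ k) + s(ℓ h, k) = (ℓ + 1)·s(h, k)` (`k ≥ 1`), the case `n = ℓ` prime of
  M. I. Knopp's `∑_{ad = n} ∑_{b mod d} s(a h + b k, d k) = σ(n)·s(h, k)` — the shadow on Dedekind sums of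
  `T_n log η`, i.e. of `T_n E₂ = σ(n) E₂`. [cite: Knopp1980, Theorem (n prime)]

Method: elementary — split the residue system modulo `ℓ k` as `μ = ℓ ν + ρ`, apply the distribution
relation in the inner sum over `m` (for `ℓ ∤ μ` the map `m ↦ m μ mod ℓ` permutes the residues), and
recognise `∑_{μ mod ℓk} ((μ/(ℓk)))·((hμ/k)) = s(h, k)` (the same computation as `s(qh, qk) = s(h, k)`).

## References
* [Knopp1980] M. I. Knopp, *Hecke operators and an identity for the Dedekind sums*, J. Number Theory 12
  (1980), 2–9, Lemma 1 and the Theorem.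
* [Apostol1990] T. M. Apostol, *Modular Functions and Dirichlet Series in Number Theory*, 2nd ed., GTM 41
  (1990), §3.7 and Exercise 3.7.
* [RademacherGrosswald1972] H. Rademacher, E. Grosswald, *Dedekind Sums*, Carus Math. Monographs 16 (1972),
  Ch. 1 eq. (1)–(2), Ch. 3 A.
-/

set_option autoImplicit false

namespace Literature.NumberTheory.ModularForms

open Finset

/-! ### §1 Reindexing lemmas over a residue system -/

/-- `∑_{μ < q k} G(μ) = ∑_{m < q} ∑_{r < k} G(m k + r)` (split a residue system modulo `qk`). [folklore] -/
private theorem sum_range_mul_eq_sum_sum (G : ℕ → ℚ) (q k : ℕ) :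
    ∑ μ ∈ range (q * k), G μ = ∑ m ∈ range q, ∑ r ∈ range k, G (m * k + r) := by
  induction q with
  | zero => simp
  | succ q ih =>
    rw [Nat.succ_mul, sum_range_add, ih, sum_range_succ]

/-- For an integer `M` and `q ≥ 1`, `m ↦ (M + m) mod q` permutes `0, …, q − 1`: reindexing a sum.
[folklore] -/
private theorem sum_range_comp_add_emod {q : ℕ} (hq : 0 < q) (M : ℤ) (f : ℤ → ℚ) :
    ∑ m ∈ range q, f ((M + m) % q) = ∑ r ∈ range q, f r := by
  have hq0 : (q : ℤ) ≠ 0 := by exact_mod_cast hq.ne'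
  have hqpos : (0 : ℤ) < q := by exact_mod_cast hq
  -- bijection `i m = toNat ((M + m) % q)` with inverse `j r = toNat ((r - M) % q)`
  refine sum_nbij' (fun m => Int.toNat ((M + m) % q)) (fun r => Int.toNat (((r : ℤ) - M) % q))
    ?_ ?_ ?_ ?_ ?_
  · intro m _
    rw [mem_range]
    have h0 : 0 ≤ (M + m) % q := Int.emod_nonneg _ hq0
    have h1 : (M + m) % q < q := Int.emod_lt_of_pos _ hqpos
    omega
  · intro r _
    rw [mem_range]
    have h0 : 0 ≤ ((r : ℤ) - M) % q := Int.emod_nonneg _ hq0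
    have h1 : ((r : ℤ) - M) % q < q := Int.emod_lt_of_pos _ hqpos
    omega
  · intro m hm
    rw [mem_range] at hm
    have h0 : 0 ≤ (M + m) % q := Int.emod_nonneg _ hq0
    have e1 : ((Int.toNat ((M + m) % q) : ℕ) : ℤ) = (M + m) % q := Int.toNat_of_nonneg h0
    have e2 : (((M + m) % q) - M) % q = (m : ℤ) % q := by
      have : ((M + m) % q - M) = (M + m - M) - q * ((M + m) / q) := by
        rw [Int.emod_def]; ring
      rw [this, show M + (m : ℤ) - M = m by ring, Int.sub_mul_emod_self_left]
    have e3 : (m : ℤ) % q = m := Int.emod_eq_of_lt (by positivity) (by exact_mod_cast hm)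
    have : Int.toNat ((((Int.toNat ((M + m) % q) : ℕ) : ℤ) - M) % q) = m := by
      rw [e1, e2, e3, Int.toNat_natCast]
    exact this
  · intro r hr
    rw [mem_range] at hr
    have h0 : 0 ≤ ((r : ℤ) - M) % q := Int.emod_nonneg _ hq0
    have e1 : ((Int.toNat (((r : ℤ) - M) % q) : ℕ) : ℤ) = ((r : ℤ) - M) % q := Int.toNat_of_nonneg h0
    have e2 : (M + ((r : ℤ) - M) % q) % q = (r : ℤ) % q := by
      have : M + ((r : ℤ) - M) % q = r - q * (((r : ℤ) - M) / q) := by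
        rw [Int.emod_def]; ring
      rw [this, Int.sub_mul_emod_self_left]
    have e3 : (r : ℤ) % q = r := Int.emod_eq_of_lt (by positivity) (by exact_mod_cast hr)
    have : Int.toNat ((M + ((Int.toNat (((r : ℤ) - M) % q) : ℕ) : ℤ)) % q) = r := by
      rw [e1, e2, e3, Int.toNat_natCast]
    exact this
  · intro m _
    have h0 : 0 ≤ (M + m) % q := Int.emod_nonneg _ hq0
    rw [Int.toNat_of_nonneg h0]

/-- For `ℓ ∤ μ`, `ℓ` prime, `m ↦ m μ mod ℓ` permutes `0, …, ℓ − 1`: reindexing a sum. [folklore] -/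
private theorem sum_range_comp_mul_mod {ℓ μ : ℕ} (hℓ : ℓ.Prime) (hμ : ¬ ℓ ∣ μ) (f : ℕ → ℚ) :
    ∑ m ∈ range ℓ, f (m * μ % ℓ) = ∑ r ∈ range ℓ, f r := by
  have hc : Nat.Coprime ℓ μ := (Nat.Prime.coprime_iff_not_dvd hℓ).mpr hμ
  have hinj : Set.InjOn (fun m => m * μ % ℓ) (range ℓ : Set ℕ) := by
    intro r hr r' hr' e
    have hm : r * μ ≡ r' * μ [MOD ℓ] := e
    exact Nat.ModEq.eq_of_lt_of_lt (Nat.ModEq.cancel_right_of_coprime hc hm)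
      (mem_range.mp (mem_coe.mp hr)) (mem_range.mp (mem_coe.mp hr'))
  have himg : (range ℓ).image (fun m => m * μ % ℓ) = range ℓ := by
    apply eq_of_subset_of_card_le
    · intro x hx
      rw [mem_image] at hx
      obtain ⟨r, -, rfl⟩ := hx
      exact mem_range.mpr (Nat.mod_lt _ hℓ.pos)
    · rw [card_image_of_injOn hinj, card_range]
  rw [← sum_image hinj, himg]

/-- `∑_{i<q} i = q(q−1)/2` in `ℚ`. [folklore] -/
private theorem sum_range_natCast_rat (q : ℕ) : ∑ i ∈ range q, (i : ℚ) = (q : ℚ) * ((q : ℚ) - 1) / 2 := by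
  induction q with
  | zero => simp
  | succ n ih => rw [sum_range_succ, ih]; push_cast; ring

/-- `∑_{i<n} (i + 1) = (n+1)n/2` in `ℚ`. [folklore] -/
private theorem sum_range_natCast_succ_rat (n : ℕ) : ∑ i ∈ range n, ((i + 1 : ℕ) : ℚ) = ((n : ℚ) + 1) * n / 2 := by
  induction n with
  | zero => simp
  | succ n ih => rw [sum_range_succ, ih]; push_cast; ring

/-! ### §2 The distribution relation of `((x))` -/

/-- `{(n + φ)/q} = ((n mod q) + φ)/q` for `n ∈ ℤ`, `0 ≤ φ < 1`, `q ≥ 1`. [folklore] -/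
private theorem fract_intCast_add_div {q : ℕ} (hq : 0 < q) (n : ℤ) {φ : ℚ} (h0 : 0 ≤ φ) (h1 : φ < 1) :
    Int.fract (((n : ℚ) + φ) / q) = (((n % q : ℤ) : ℚ) + φ) / q := by
  have hq' : (0 : ℚ) < q := by exact_mod_cast hq
  have hq0 : (q : ℤ) ≠ 0 := by exact_mod_cast hq.ne'
  have hmod0 : (0 : ℚ) ≤ ((n % q : ℤ) : ℚ) := by exact_mod_cast Int.emod_nonneg n hq0
  rw [Int.fract_eq_iff]
  refine ⟨div_nonneg (add_nonneg hmod0 h0) hq'.le, ?_, ⟨n / q, ?_⟩⟩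
  · rw [div_lt_one hq']
    have : ((n % q : ℤ) : ℚ) ≤ (q : ℚ) - 1 := by
      have h := Int.emod_lt_of_pos n (show (0 : ℤ) < q by exact_mod_cast hq)
      have : n % q ≤ q - 1 := by omega
      exact_mod_cast this
    linarith
  · have e : (n : ℚ) = (q : ℚ) * ((n / q : ℤ) : ℚ) + ((n % q : ℤ) : ℚ) := by
      have := Int.emod_add_ediv_mul n q
      have e' : (n : ℚ) = ((n % q : ℤ) : ℚ) + ((n / q : ℤ) : ℚ) * (q : ℚ) := by exact_mod_cast this.symm
      rw [e']; ring
    rw [e]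
    field_simp
    ring

/-- `((x))` as a function of the fractional part: `((x)) = F({x})` with `F(0) = 0`, `F(f) = f − ½`.
[cite: RademacherGrosswald1972, Ch. 1 eq. (2)] -/
theorem dedekindSaw_eq_ite_fract (x : ℚ) :
    dedekindSaw x = if Int.fract x = 0 then 0 else Int.fract x - 1 / 2 := rfl

/-- **Distribution relation of the sawtooth function**: `∑_{m=0}^{q−1} ((x + m/q)) = ((q x))` for `q ≥ 1`.
(Writing `qx = M + φ`, the fractional parts `{x + m/q} = ((M + m) mod q + φ)/q` run over `(r + φ)/q`,
`r = 0, …, q − 1`.) [cite: Knopp1980, Lemma 1] [cite: RademacherGrosswald1972, Ch. 3 A] -/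
theorem sum_dedekindSaw_add_div {q : ℕ} (hq : 0 < q) (x : ℚ) :
    ∑ m ∈ range q, dedekindSaw (x + (m : ℚ) / q) = dedekindSaw ((q : ℚ) * x) := by
  have hq' : (0 : ℚ) < q := by exact_mod_cast hq
  have hqne : (q : ℚ) ≠ 0 := hq'.ne'
  set y : ℚ := (q : ℚ) * x with hy
  set M : ℤ := ⌊y⌋ with hM
  set φ : ℚ := Int.fract y with hφ
  have hφ0 : 0 ≤ φ := Int.fract_nonneg y
  have hφ1 : φ < 1 := Int.fract_lt_one y
  have hyMφ : y = M + φ := by rw [hφ, hM, Int.floor_add_fract]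
  -- each summand as a function of `(M + m) % q`
  have hterm : ∀ m : ℕ, dedekindSaw (x + (m : ℚ) / q) =
      (fun r : ℤ => if ((r : ℚ) + φ) / q = 0 then (0 : ℚ) else ((r : ℚ) + φ) / q - 1 / 2)
        ((M + m) % q) := by
    intro m
    have e : x + (m : ℚ) / q = (((M + m : ℤ) : ℚ) + φ) / q := by
      have : x = y / q := by rw [hy]; field_simp
      rw [this, hyMφ]; push_cast; field_simp; ring
    rw [e, dedekindSaw_eq_ite_fract, fract_intCast_add_div hq _ hφ0 hφ1]
  rw [sum_congr rfl fun m _ => hterm m,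
    sum_range_comp_add_emod hq M
      (fun r : ℤ => if ((r : ℚ) + φ) / q = 0 then (0 : ℚ) else ((r : ℚ) + φ) / q - 1 / 2)]
  -- now evaluate `∑_{r<q} F((r + φ)/q)`
  by_cases hφz : φ = 0
  · -- `qx ∈ ℤ`: the `r = 0` term vanishes, the others are `r/q − 1/2`, summing to `0`
    have hR : dedekindSaw y = 0 := dedekindSaw_of_fract_eq_zero (by rw [← hφ]; exact hφz)
    rw [hR]
    have e : ∀ r ∈ range q, (if (((r : ℤ) : ℚ) + φ) / q = 0 then (0 : ℚ) else (((r : ℤ) : ℚ) + φ) / q - 1 / 2)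
        = dedekindSaw ((r : ℚ) / q) := by
      intro r hr
      rw [hφz, add_zero, Int.cast_natCast]
      rcases Nat.eq_zero_or_pos r with rfl | hr0
      · simp
      · have hlt : (r : ℚ) / q < 1 := by
          rw [div_lt_one hq']; exact_mod_cast mem_range.mp hr
        have hpos : (0 : ℚ) < (r : ℚ) / q := div_pos (by exact_mod_cast hr0) hq'
        rw [if_neg hpos.ne', dedekindSaw_of_pos_of_lt_one hpos hlt]
    rw [sum_congr rfl e]
    -- `∑_{r<q} ((r/q)) = 0`
    obtain ⟨n, rfl⟩ : ∃ n, q = n + 1 := ⟨q - 1, (Nat.sub_add_cancel hq).symm⟩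
    rw [sum_range_succ']
    simp only [Nat.cast_zero, zero_div, dedekindSaw_zero, add_zero]
    have e2 : ∀ i ∈ range n, dedekindSaw (((i + 1 : ℕ) : ℚ) / ((n + 1 : ℕ) : ℚ)) =
        ((i + 1 : ℕ) : ℚ) / ((n + 1 : ℕ) : ℚ) - 1 / 2 := by
      intro i hi
      have hi' := mem_range.mp hi
      apply dedekindSaw_of_pos_of_lt_one
      · positivity
      · rw [div_lt_one (by positivity)]; exact_mod_cast Nat.succ_lt_succ hi'
    rw [sum_congr rfl e2, sum_sub_distrib, ← sum_div]
    rw [sum_range_natCast_succ_rat n]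
    simp only [sum_const, card_range, nsmul_eq_mul]
    push_cast
    field_simp
    ring
  · -- `qx ∉ ℤ`: every term is `(r + φ)/q − 1/2`
    have hR : dedekindSaw y = φ - 1 / 2 := dedekindSaw_of_fract_ne_zero (by rw [← hφ]; exact hφz)
    rw [hR]
    have e : ∀ r ∈ range q, (if (((r : ℤ) : ℚ) + φ) / q = 0 then (0 : ℚ) else (((r : ℤ) : ℚ) + φ) / q - 1 / 2)
        = ((r : ℚ) + φ) / q - 1 / 2 := by
      intro r _
      rw [Int.cast_natCast]
      have hpos : (0 : ℚ) < ((r : ℚ) + φ) / q := by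
        apply div_pos _ hq'
        have : (0 : ℚ) < φ := lt_of_le_of_ne hφ0 (Ne.symm hφz)
        positivity
      rw [if_neg hpos.ne']
    rw [sum_congr rfl e, sum_sub_distrib, ← sum_div, sum_add_distrib]
    rw [sum_range_natCast_rat q]
    simp only [sum_const, card_range, nsmul_eq_mul]
    field_simp
    ring

/-- Distribution relation, multiplicative reindexing: for `ℓ` prime and `ℓ ∤ μ`,
`∑_{m=0}^{ℓ−1} ((x + m μ/ℓ)) = ((ℓ x))`. [cite: Knopp1980, Lemma 1] -/
theorem sum_dedekindSaw_add_mul_div {ℓ μ : ℕ} (hℓ : ℓ.Prime) (hμ : ¬ ℓ ∣ μ) (x : ℚ) :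
    ∑ m ∈ range ℓ, dedekindSaw (x + (m : ℚ) * μ / ℓ) = dedekindSaw ((ℓ : ℚ) * x) := by
  have hℓ' : (ℓ : ℚ) ≠ 0 := by exact_mod_cast hℓ.ne_zero
  have e : ∀ m ∈ range ℓ, dedekindSaw (x + (m : ℚ) * μ / ℓ) =
      (fun r : ℕ => dedekindSaw (x + (r : ℚ) / ℓ)) (m * μ % ℓ) := by
    intro m _
    have h : (m : ℚ) * μ / ℓ = ((m * μ / ℓ : ℕ) : ℚ) + ((m * μ % ℓ : ℕ) : ℚ) / ℓ := by
      have := (Nat.div_add_mod (m * μ) ℓ)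
      have e' : ((m * μ : ℕ) : ℚ) = (ℓ : ℚ) * ((m * μ / ℓ : ℕ) : ℚ) + ((m * μ % ℓ : ℕ) : ℚ) := by
        exact_mod_cast this.symm
      push_cast at e'
      field_simp
      linarith
    simp only
    rw [h, ← add_assoc, show x + ((m * μ / ℓ : ℕ) : ℚ) = ((m * μ / ℓ : ℕ) : ℚ) + x from add_comm _ _,
      add_assoc, show (((m * μ / ℓ : ℕ) : ℚ)) = (((m * μ / ℓ : ℕ) : ℤ) : ℚ) by push_cast; rfl,
      dedekindSaw_intCast_add]
  rw [sum_congr rfl e, sum_range_comp_mul_mod hℓ hμ (fun r : ℕ => dedekindSaw (x + (r : ℚ) / ℓ))]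
  exact sum_dedekindSaw_add_div hℓ.pos x

/-! ### §3 `s(qh, qk) = s(h, k)` -/

/-- `∑_{μ mod qk} ((μ/(qk)))·((hμ/k)) = s(h, k)` for `q ≥ 1`: split `μ = m k + r` and apply the
distribution relation to `∑_m ((r/(qk) + m/q)) = ((r/k))`. [cite: Apostol1990, Ch. 3, Exercise 7] -/
theorem sum_dedekindSaw_div_mul_mul_dedekindSaw {q : ℕ} (hq : 0 < q) (h : ℤ) (k : ℕ) :
    ∑ μ ∈ range (q * k), dedekindSaw ((μ : ℚ) / ((q * k : ℕ) : ℚ)) * dedekindSaw ((h : ℚ) * μ / k) =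
      dedekindSum h k := by
  rcases Nat.eq_zero_or_pos k with rfl | hk
  · simp
  have hk' : (k : ℚ) ≠ 0 := by exact_mod_cast hk.ne'
  have hq' : (q : ℚ) ≠ 0 := by exact_mod_cast hq.ne'
  rw [sum_range_mul_eq_sum_sum, sum_comm, dedekindSum_def]
  refine sum_congr rfl fun r _ => ?_
  have e1 : ∀ m ∈ range q, dedekindSaw (((m * k + r : ℕ) : ℚ) / ((q * k : ℕ) : ℚ)) *
      dedekindSaw ((h : ℚ) * ((m * k + r : ℕ) : ℚ) / k) =
      dedekindSaw ((r : ℚ) / ((q * k : ℕ) : ℚ) + (m : ℚ) / q) * dedekindSaw ((h : ℚ) * r / k) := by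
    intro m _
    have ea : ((m * k + r : ℕ) : ℚ) / ((q * k : ℕ) : ℚ) = (r : ℚ) / ((q * k : ℕ) : ℚ) + (m : ℚ) / q := by
      push_cast; field_simp; ring
    have eb : (h : ℚ) * ((m * k + r : ℕ) : ℚ) / k = (h : ℚ) * r / k + ((h * m : ℤ) : ℚ) := by
      push_cast; field_simp; ring
    rw [ea, eb, dedekindSaw_add_intCast]
  rw [sum_congr rfl e1, ← sum_mul, sum_dedekindSaw_add_div hq]
  congr 2
  push_cast; field_simp

/-- **`s(qh, qk) = s(h, k)`** for `q ≥ 1` (with `s(h, k) = ∑_{μ mod k} ((μ/k))((hμ/k))` summed over a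
full residue system). [cite: Apostol1990, Ch. 3, Exercise 7] -/
theorem dedekindSum_mul_left_mul_right {q : ℕ} (hq : 0 < q) (h : ℤ) (k : ℕ) :
    dedekindSum ((q : ℤ) * h) (q * k) = dedekindSum h k := by
  rcases Nat.eq_zero_or_pos k with rfl | hk
  · simp
  have hk' : (k : ℚ) ≠ 0 := by exact_mod_cast hk.ne'
  have hq' : (q : ℚ) ≠ 0 := by exact_mod_cast hq.ne'
  rw [dedekindSum_def, ← sum_dedekindSaw_div_mul_mul_dedekindSaw hq h k]
  refine sum_congr rfl fun μ _ => ?_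
  congr 2
  push_cast; field_simp

/-! ### §4 Knopp's identity at a prime -/

/-- **Knopp's identity for a prime `ℓ`** (`k ≥ 1`):
`∑_{m=0}^{ℓ−1} s(h + m k, ℓ k) + s(ℓ h, k) = (ℓ + 1)·s(h, k)` — the terms `(a, d) = (1, ℓ)` and
`(ℓ, 1)` of `∑_{ad=ℓ} ∑_{b mod d} s(ah + bk, dk) = σ(ℓ) s(h, k)`. [cite: Knopp1980, Theorem (n prime)] -/
theorem sum_dedekindSum_add_mul_eq {ℓ : ℕ} (hℓ : ℓ.Prime) (h : ℤ) {k : ℕ} (hk : 0 < k) :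
    ∑ m ∈ range ℓ, dedekindSum (h + m * k) (ℓ * k) + dedekindSum ((ℓ : ℤ) * h) k =
      ((ℓ : ℚ) + 1) * dedekindSum h k := by
  have hk' : (k : ℚ) ≠ 0 := by exact_mod_cast hk.ne'
  have hℓ' : (ℓ : ℚ) ≠ 0 := by exact_mod_cast hℓ.ne_zero
  -- notation: `A μ = ((μ/(ℓk)))`, `B μ = ((hμ/k))`, `I μ = ∑_m ((hμ/(ℓk) + mμ/ℓ))`
  set A : ℕ → ℚ := fun μ => dedekindSaw ((μ : ℚ) / ((ℓ * k : ℕ) : ℚ)) with hA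
  set B : ℕ → ℚ := fun μ => dedekindSaw ((h : ℚ) * μ / k) with hB
  set I : ℕ → ℚ := fun μ => ∑ m ∈ range ℓ,
    dedekindSaw ((h : ℚ) * μ / ((ℓ * k : ℕ) : ℚ) + (m : ℚ) * μ / ℓ) with hI
  -- Step 1: swap the sums
  have step1 : ∑ m ∈ range ℓ, dedekindSum (h + m * k) (ℓ * k) = ∑ μ ∈ range (ℓ * k), A μ * I μ := by
    simp only [hA, hI, dedekindSum_def, mul_sum]
    rw [sum_comm]
    refine sum_congr rfl fun μ _ => sum_congr rfl fun m _ => ?_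
    congr 2
    push_cast; field_simp
  -- Step 2: split `μ = ν ℓ + ρ`
  have hsplit : ∀ G : ℕ → ℚ, ∑ μ ∈ range (ℓ * k), G μ = ∑ ν ∈ range k, ∑ ρ ∈ range ℓ, G (ν * ℓ + ρ) := by
    intro G; rw [mul_comm ℓ k]; exact sum_range_mul_eq_sum_sum G k ℓ
  -- Step 3: the inner sum: `ℓ·((hν/k))` if `ρ = 0`, `((hμ/k))` if `ρ ≠ 0` (distribution relation)
  have inner : ∀ ν ∈ range k, ∀ ρ ∈ range ℓ,
      I (ν * ℓ + ρ) = if ρ = 0 then (ℓ : ℚ) * dedekindSaw ((h : ℚ) * ν / k) else B (ν * ℓ + ρ) := by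
    intro ν _ ρ hρ
    simp only [hI, hB]
    split_ifs with hρ0
    · subst hρ0
      have e : ∀ m ∈ range ℓ, dedekindSaw ((h : ℚ) * ((ν * ℓ + 0 : ℕ) : ℚ) / ((ℓ * k : ℕ) : ℚ) +
          (m : ℚ) * ((ν * ℓ + 0 : ℕ) : ℚ) / ℓ) = dedekindSaw ((h : ℚ) * ν / k) := by
        intro m _
        have : (h : ℚ) * ((ν * ℓ + 0 : ℕ) : ℚ) / ((ℓ * k : ℕ) : ℚ) + (m : ℚ) * ((ν * ℓ + 0 : ℕ) : ℚ) / ℓ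
            = (h : ℚ) * ν / k + ((m * ν : ℤ) : ℚ) := by
          push_cast; field_simp; ring
        rw [this, dedekindSaw_add_intCast]
      rw [sum_congr rfl e, sum_const, card_range, nsmul_eq_mul]
    · have hnd : ¬ ℓ ∣ (ν * ℓ + ρ) := by
        intro hd
        have : ℓ ∣ ρ := (Nat.dvd_add_right (Dvd.intro_left ν rfl)).mp hd
        exact hρ0 (Nat.eq_zero_of_dvd_of_lt this (mem_range.mp hρ))
      rw [sum_dedekindSaw_add_mul_div hℓ hnd]
      congr 1
      push_cast; field_simp
  -- Step 4: the three sums as double sums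
  have eL : ∑ m ∈ range ℓ, dedekindSum (h + m * k) (ℓ * k) =
      ∑ ν ∈ range k, ∑ ρ ∈ range ℓ,
        A (ν * ℓ + ρ) * (if ρ = 0 then (ℓ : ℚ) * dedekindSaw ((h : ℚ) * ν / k) else B (ν * ℓ + ρ)) := by
    rw [step1, hsplit]
    exact sum_congr rfl fun ν hν => sum_congr rfl fun ρ hρ => by rw [inner ν hν ρ hρ]
  have eS : dedekindSum h k = ∑ ν ∈ range k, ∑ ρ ∈ range ℓ, A (ν * ℓ + ρ) * B (ν * ℓ + ρ) := by
    rw [← sum_dedekindSaw_div_mul_mul_dedekindSaw hℓ.pos h k, hsplit]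
  have ediff : (∑ ν ∈ range k, ∑ ρ ∈ range ℓ,
        A (ν * ℓ + ρ) * (if ρ = 0 then (ℓ : ℚ) * dedekindSaw ((h : ℚ) * ν / k) else B (ν * ℓ + ρ))) -
      (∑ ν ∈ range k, ∑ ρ ∈ range ℓ, A (ν * ℓ + ρ) * B (ν * ℓ + ρ)) =
      ∑ ν ∈ range k, A (ν * ℓ + 0) * ((ℓ : ℚ) * dedekindSaw ((h : ℚ) * ν / k) - B (ν * ℓ + 0)) := by
    rw [← sum_sub_distrib]
    refine sum_congr rfl fun ν _ => ?_
    rw [← sum_sub_distrib]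
    rw [sum_congr rfl fun ρ _ => show A (ν * ℓ + ρ) *
        (if ρ = 0 then (ℓ : ℚ) * dedekindSaw ((h : ℚ) * ν / k) else B (ν * ℓ + ρ)) -
        A (ν * ℓ + ρ) * B (ν * ℓ + ρ) =
        if ρ = 0 then A (ν * ℓ + 0) * ((ℓ : ℚ) * dedekindSaw ((h : ℚ) * ν / k) - B (ν * ℓ + 0)) else 0 by
      split_ifs with h0
      · subst h0; ring
      · ring]
    rw [sum_ite_eq' (range ℓ) 0]
    rw [if_pos (mem_range.mpr hℓ.pos)]
  have eU : ∑ ν ∈ range k, A (ν * ℓ + 0) * ((ℓ : ℚ) * dedekindSaw ((h : ℚ) * ν / k) - B (ν * ℓ + 0)) =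
      (ℓ : ℚ) * dedekindSum h k - dedekindSum ((ℓ : ℤ) * h) k := by
    rw [dedekindSum_def, dedekindSum_def, mul_sum, ← sum_sub_distrib]
    refine sum_congr rfl fun ν _ => ?_
    have eA0 : A (ν * ℓ + 0) = dedekindSaw ((ν : ℚ) / k) := by
      simp only [hA]; congr 1; push_cast; field_simp; ring
    have eB0 : B (ν * ℓ + 0) = dedekindSaw ((((ℓ : ℤ) * h : ℤ) : ℚ) * ν / k) := by
      simp only [hB]; congr 1; push_cast; ring
    rw [eA0, eB0]
    ring
  linear_combination eL + ediff - eS + eU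

end Literature.NumberTheory.ModularForms
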